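import Literature.NumberTheory.EllipticCurves.ZpExtensionEisensteinDVRSetting
import Literature.NumberTheory.EllipticCurves.ZpExtensionEisensteinSelmerTowerCompatProofs
import Literature.NumberTheory.EllipticCurves.ZpExtensionEisensteinSelmerComplexPlacesProofs
import Literature.NumberTheory.GaloisRepresentations.UnramifiedSubgroupMapSurjective
import HarnessLib

/-!
# The Eisenstein `DVRSetting` of the curve: the Selmer-compatibility clauses `cond_smul` and `cond_red` of
# `SatisfiesH` (proofs file)

Topic `NumberTheory/EllipticCurves` (D1 road of cell `pub/bsd-print-x9`; companion of `ZpExtensionEisensteinDVRSetting`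
and `…EisensteinDVRSettingBookkeepingProofs`).  THEOREMS ONLY; no definition, no named fact, no instance, no notation,
no `sorry`.

Howard's typing clause T4 of `DVRSetting.SatisfiesH` (part B of the cell's (W9)): «the local conditions are `R`-submodules
[Def. 1.1.1, arXiv:1202.6340 p. 5 L20–21] and level `k`'s are the reductions of level `k+1`'s» — the fields `cond_smul`
and `cond_red`.  For the curve's Eisenstein setting `S := W.eisensteinDVRSetting κ hm S hpS hbad L hL hLS jbar cd D fs`
(local conditions `F_𝔮` = `ZpExtension.eisensteinSelmerStructure` at torsion level `k+1`):
* `eisensteinDVRSetting_cond_smul` — `cond_smul`, every place (the tree's `map_scalarMapH1_eisensteinSelmerStructure_le`,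
  p644358, read on the shifted tower);
* `eisensteinDVRSetting_cond_red_le` — the inclusion of `cond_red` at every place (`map_red_eisensteinSelmerStructure_le`);
* **`eisensteinDVRSetting_cond_red`** — `cond_red` (EQUALITY) at every place, for `K` totally complex (the source: `K`
  imaginary quadratic): at `v ∣ p` and at `v ∈ S` the tree's `map_red_eisensteinSelmerStructure_eq_of_mem[_finset]`
  (saturated level conditions), at the complex places `…_eq_inl_of_isTotallyComplex` (p644861: `H¹(K_w, ·) = 0`), and at
  the remaining finite places `v ∉ S`, `v ∤ p` — where `F_𝔮` is the unramified condition ON THE NOSE and `T^{(k)}` is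
  unramified (`isUnramifiedAt_eisensteinTwist_torsionGaloisModule_of_not_mem`, Néron–Ogg–Shafarevich + Washington 13.2) —
  the tree's `galoisCohomology.map_localMap_unramifiedSubgroup_eq_of_surjective` (p646745: `H¹(f)(H¹_ur) = H¹_ur` for `f`
  onto out of a finite unramified module; Serre, *Local Fields* XIII §1 Prop. 1).
Every statement carries the CONSUMER PREAMBLE of `ZpExtensionEisensteinDVRSetting`.  BSD is not proved by any of this.

References: [Howard2004HeegnerKolyvagin] Def. 1.1.1, Def. 1.1.3, §1.6 (arXiv p. 5 L20–24, p. 12 L29–55), Def. 3.1.2;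
[SerreLocalFields1979] XIII §1 Prop. 1; [MazurRubinMemoirs2004] Lemma 1.1.5; [SilvermanAEC2009] VII.4.1.
-/

set_option autoImplicit false

noncomputable section

open Function NumberField IsDedekindDomain Field
open scoped NumberField ContRepresentation TensorProduct Classical

namespace WeierstrassCurve

open Literature.NumberTheory.EllipticCurves Literature.NumberTheory.GaloisRepresentations
open Literature.NumberTheory.GaloisRepresentations.DiscreteGaloisModule
open Literature.NumberTheory.GaloisCohomology.Howard2004
open Literature.NumberTheory.EllipticCurves.ZpExtension (EisensteinLevel)

variable {K : Type} [Field K] [NumberField K] (W : WeierstrassCurve ℚ) [W.IsElliptic] {p : ℕ} [hp : Fact p.Prime]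
  (κ : ZpExtension K p) {m : ℕ} (hm : 1 ≤ m)
  (S : Finset (HeightOneSpectrum (𝓞 K)))
  (hpS : ∀ v : HeightOneSpectrum (𝓞 K), ((p : ℕ) : 𝓞 K) ∈ v.asIdeal → v ∈ S)
  (hbad : ∀ v : HeightOneSpectrum (𝓞 K), v ∉ S → ((p : ℕ) : 𝓞 K) ∉ v.asIdeal → (W.baseChange K).HasGoodReductionAt v)
  (L : Set (HeightOneSpectrum (𝓞 K)))
  (hL : letI := IwasawaAlgebra.isLocalRing_quotient_X_pow_add_C p hm
    L ⊆ (W.eisensteinTower κ hm).degreeTwoPrimes p)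
  (hLS : ∀ v ∈ L, v ∉ S)
  (jbar : AlgebraicClosure K →+* ℂ) (cd : ConjugationDatum K)
  (D : letI := IwasawaAlgebra.isLocalRing_quotient_X_pow_add_C p hm
    ∀ k, DualityDatum p cd ((W.eisensteinTower κ hm).ρ k) (IwasawaAlgebra.EisensteinCoeff p m (k + 1)))
  (fs : letI := IwasawaAlgebra.isLocalRing_quotient_X_pow_add_C p hm
    ∀ (k : ℕ) (n : Finset (HeightOneSpectrum (𝓞 K))) (v : HeightOneSpectrum (𝓞 K)),
      galoisCohomology ((W.eisensteinLevelQuot κ hm k n).toLocal (Sum.inr v)) 1 →+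
        SingularQuotient (GaloisRep.toLocal v (W.eisensteinLevelQuot κ hm k n)) ⊗[ℤ] Gell v)

set_option synthInstance.maxHeartbeats 80000 in
/-- **`SatisfiesH.cond_smul` for the Eisenstein setting**: at every place and every level, `F_𝔮` is stable under the
local scalar action of `S_m` (Howard: local conditions are `R`-submodules).
[cite: Howard2004HeegnerKolyvagin, Def. 1.1.1 (arXiv Def. 2.1.1, p. 5, L20–21)] -/
theorem eisensteinDVRSetting_cond_smul (k : ℕ) (v : NumberField.Place K)
    (r : IwasawaAlgebra p ⧸ Ideal.span {(PowerSeries.X ^ m + PowerSeries.C (p : ℤ_[p]) : IwasawaAlgebra p)}) :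
    letI := IwasawaAlgebra.isDomain_quotient_X_pow_add_C p hm
    letI := IwasawaAlgebra.isDiscreteValuationRing_quotient_X_pow_add_C p hm
    haveI := IwasawaAlgebra.EisensteinCoeff.isLocalRing_succ p hm
    letI := IwasawaAlgebra.EisensteinCoeff.algebraOfSpecSucc p m
    haveI := W.isScalarTower_algebraOfSpecSucc (K := K) (p := p) (m := m)
    letI := W.residueModuleSucc (K := K) (p := p) hm
    (((W.eisensteinDVRSetting κ hm S hpS hbad L hL hLS jbar cd D fs).t k).cond v).map
        (galoisCohomology.scalarMapH1 (((W.eisensteinDVRSetting κ hm S hpS hbad L hL hLS jbar cd D fs).T.ρ k).toLocal v) (((W.eisensteinDVRSetting κ hm S hpS hbad L hL hLS jbar cd D fs).T.hlin k).restrictField _) r) ≤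
      ((W.eisensteinDVRSetting κ hm S hpS hbad L hL hLS jbar cd D fs).t k).cond v :=
  κ.map_scalarMapH1_eisensteinSelmerStructure_le (fun j ↦ (W.baseChange K).torsionGaloisModule ((p : ℤ) ^ j))
      (fun j ↦ (W.baseChange K).torsionGaloisModuleReduce p j) hm
      (fun j ↦ (W.baseChange K).torsionGaloisModuleReduce_surjective p j) S
      (fun v _ ↦ (W.baseChange K).ordinaryFiltrationAt v (fun j ↦ (W.baseChange K).torsionGaloisModuleReduce p j)
        (fun _ _ ↦ rfl)) (k + 1) v r

set_option synthInstance.maxHeartbeats 80000 in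
/-- **`SatisfiesH.cond_red` for the Eisenstein setting, the inclusion** at every place: the reduction
`T^{(k+1)} ↠ T^{(k)}` maps `F_𝔮` at torsion level `k+2` into `F_𝔮` at torsion level `k+1`.
[cite: Howard2004HeegnerKolyvagin, Def. 1.1.3 and §1.6 (arXiv p. 5 L93–99, p. 12 L29–55)] -/
theorem eisensteinDVRSetting_cond_red_le (k : ℕ) (v : NumberField.Place K) :
    letI := IwasawaAlgebra.isDomain_quotient_X_pow_add_C p hm
    letI := IwasawaAlgebra.isDiscreteValuationRing_quotient_X_pow_add_C p hm
    haveI := IwasawaAlgebra.EisensteinCoeff.isLocalRing_succ p hm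
    letI := IwasawaAlgebra.EisensteinCoeff.algebraOfSpecSucc p m
    haveI := W.isScalarTower_algebraOfSpecSucc (K := K) (p := p) (m := m)
    letI := W.residueModuleSucc (K := K) (p := p) hm
    (((W.eisensteinDVRSetting κ hm S hpS hbad L hL hLS jbar cd D fs).t (k + 1)).cond v).map
        (ContinuousRep.cohomologyMap (((W.eisensteinDVRSetting κ hm S hpS hbad L hL hLS jbar cd D fs).T.ρ (k + 1)).toLocal v) (((W.eisensteinDVRSetting κ hm S hpS hbad L hL hLS jbar cd D fs).T.ρ k).toLocal v)
          ((W.eisensteinDVRSetting κ hm S hpS hbad L hL hLS jbar cd D fs).T.red k).toAddMonoidHom continuous_of_discreteTopology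
          (fun _ x ↦ (W.eisensteinDVRSetting κ hm S hpS hbad L hL hLS jbar cd D fs).T.red_equivariant k _ x) 1) ≤
      ((W.eisensteinDVRSetting κ hm S hpS hbad L hL hLS jbar cd D fs).t k).cond v :=
  κ.map_red_eisensteinSelmerStructure_le (fun j ↦ (W.baseChange K).torsionGaloisModule ((p : ℤ) ^ j))
      (fun j ↦ (W.baseChange K).torsionGaloisModuleReduce p j) hm
      (fun j ↦ (W.baseChange K).torsionGaloisModuleReduce_surjective p j) S
      (fun v _ ↦ (W.baseChange K).ordinaryFiltrationAt v (fun j ↦ (W.baseChange K).torsionGaloisModuleReduce p j)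
        (fun _ _ ↦ rfl)) (k + 1) v

set_option synthInstance.maxHeartbeats 80000 in
/-- **`SatisfiesH.cond_red` for the Eisenstein setting** (`K` totally complex — in the source `K` is imaginary
quadratic): at EVERY place the reduction maps `F_𝔮` at tower level `k+1` ONTO `F_𝔮` at tower level `k` — at `v ∣ p` and
`v ∈ S` by saturation of the level conditions, at the complex places because `H¹(K_w, ·) = 0`, and at the good places
`v ∉ S`, `v ∤ p` because `H¹(f)` maps `H¹_ur` onto `H¹_ur` for `f` onto out of a finite module unramified at `v`.
[cite: Howard2004HeegnerKolyvagin, Def. 1.1.3 and §1.6 (arXiv p. 5 L93–99, p. 12 L29–55), Def. 3.1.2]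
[cite: SerreLocalFields1979, XIII §1 Prop. 1] [cite: SilvermanAEC2009, Prop. VII.4.1] -/
theorem eisensteinDVRSetting_cond_red [NumberField.IsTotallyComplex K] (k : ℕ) (v : NumberField.Place K) :
    letI := IwasawaAlgebra.isDomain_quotient_X_pow_add_C p hm
    letI := IwasawaAlgebra.isDiscreteValuationRing_quotient_X_pow_add_C p hm
    haveI := IwasawaAlgebra.EisensteinCoeff.isLocalRing_succ p hm
    letI := IwasawaAlgebra.EisensteinCoeff.algebraOfSpecSucc p m
    haveI := W.isScalarTower_algebraOfSpecSucc (K := K) (p := p) (m := m)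
    letI := W.residueModuleSucc (K := K) (p := p) hm
    (((W.eisensteinDVRSetting κ hm S hpS hbad L hL hLS jbar cd D fs).t (k + 1)).cond v).map
        (ContinuousRep.cohomologyMap (((W.eisensteinDVRSetting κ hm S hpS hbad L hL hLS jbar cd D fs).T.ρ (k + 1)).toLocal v) (((W.eisensteinDVRSetting κ hm S hpS hbad L hL hLS jbar cd D fs).T.ρ k).toLocal v)
          ((W.eisensteinDVRSetting κ hm S hpS hbad L hL hLS jbar cd D fs).T.red k).toAddMonoidHom continuous_of_discreteTopology
          (fun _ x ↦ (W.eisensteinDVRSetting κ hm S hpS hbad L hL hLS jbar cd D fs).T.red_equivariant k _ x) 1) =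
      ((W.eisensteinDVRSetting κ hm S hpS hbad L hL hLS jbar cd D fs).t k).cond v := by
  letI := IwasawaAlgebra.isDomain_quotient_X_pow_add_C p hm
  letI := IwasawaAlgebra.isDiscreteValuationRing_quotient_X_pow_add_C p hm
  haveI := IwasawaAlgebra.EisensteinCoeff.isLocalRing_succ p hm
  letI := IwasawaAlgebra.EisensteinCoeff.algebraOfSpecSucc p m
  haveI := W.isScalarTower_algebraOfSpecSucc (K := K) (p := p) (m := m)
  letI := W.residueModuleSucc (K := K) (p := p) hm
  let ρE := fun j ↦ (W.baseChange K).torsionGaloisModule ((p : ℤ) ^ j)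
  let tE : ∀ j, (ρE (j + 1)).toContRepresentation →ⁱL (ρE j).toContRepresentation :=
    fun j ↦ (W.baseChange K).torsionGaloisModuleReduce p j
  have htE : ∀ j, Function.Surjective (tE j) := fun j ↦ (W.baseChange K).torsionGaloisModuleReduce_surjective p j
  let ΦE : ∀ v : HeightOneSpectrum (𝓞 K), ((p : ℕ) : 𝓞 K) ∈ v.asIdeal → ZpExtension.OrdinaryFiltration ρE tE v :=
    fun v _ ↦ (W.baseChange K).ordinaryFiltrationAt v tE (fun _ _ ↦ rfl)
  rcases v with w | v
  · exact κ.map_red_eisensteinSelmerStructure_eq_inl_of_isTotallyComplex ρE tE hm htE S ΦE (k + 1) w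
  · by_cases hv : ((p : ℕ) : 𝓞 K) ∈ v.asIdeal
    · exact κ.map_red_eisensteinSelmerStructure_eq_of_mem ρE tE hm htE S ΦE (k + 1) hv
    · by_cases hvS : v ∈ S
      · exact κ.map_red_eisensteinSelmerStructure_eq_of_mem_finset ρE tE hm htE S ΦE (k + 1) hv hvS
      · -- good place `v ∉ S`, `v ∤ p`: both conditions are `H¹_ur` on the nose, the levels are unramified at `v`
        have hfin : Finite (geomTorsion (W.baseChange K) ((p : ℤ) ^ (k + 1 + 1))) :=
          finite_torsionPoints_holds (W.baseChange K) (AlgebraicClosure K)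
            (pow_ne_zero _ (by exact_mod_cast hp.out.ne_zero))
        haveI : Finite (IwasawaAlgebra.EisensteinCoeff.Twisted p m (k + 1 + 1)
            (geomTorsion (W.baseChange K) ((p : ℤ) ^ (k + 1 + 1)))) :=
          IwasawaAlgebra.EisensteinCoeff.finite_twisted (p := p) (k := k + 1 + 1) hm
        have hur := (W.baseChange K).isUnramifiedAt_eisensteinTwist_torsionGaloisModule_of_not_mem κ hm hbad hvS hv
          (k + 1 + 1)
        have h := galoisCohomology.map_localMap_unramifiedSubgroup_eq_of_surjective
          (κ.eisensteinTwist ((W.baseChange K).torsionGaloisModule ((p : ℤ) ^ (k + 1 + 1))) hm (k + 1 + 1))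
          (κ.eisensteinTwist ((W.baseChange K).torsionGaloisModule ((p : ℤ) ^ (k + 1))) hm (k + 1))
          (κ.eisensteinTwistReduce hm (Nat.le_succ (k + 1)) ((W.baseChange K).torsionGaloisModuleReduce p (k + 1)))
          (κ.eisensteinTwistReduce_surjective hm (Nat.le_succ (k + 1)) _
            ((W.baseChange K).torsionGaloisModuleReduce_surjective p (k + 1))) hur
        have e1 : ((W.eisensteinDVRSetting κ hm S hpS hbad L hL hLS jbar cd D fs).t (k + 1)).cond (Sum.inr v) =
            unramifiedSubgroup (GaloisRep.toLocal v
              (κ.eisensteinTwist ((W.baseChange K).torsionGaloisModule ((p : ℤ) ^ (k + 1 + 1))) hm (k + 1 + 1))) 1 :=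
          κ.eisensteinSelmerStructure_inr_of_not_mem ρE tE hm S ΦE (k + 1 + 1) hv hvS
        have e2 : ((W.eisensteinDVRSetting κ hm S hpS hbad L hL hLS jbar cd D fs).t k).cond (Sum.inr v) =
            unramifiedSubgroup (GaloisRep.toLocal v
              (κ.eisensteinTwist ((W.baseChange K).torsionGaloisModule ((p : ℤ) ^ (k + 1))) hm (k + 1))) 1 :=
          κ.eisensteinSelmerStructure_inr_of_not_mem ρE tE hm S ΦE (k + 1) hv hvS
        have e3 : ContinuousRep.cohomologyMap (((W.eisensteinDVRSetting κ hm S hpS hbad L hL hLS jbar cd D fs).T.ρ (k + 1)).toLocal (Sum.inr v))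
            (((W.eisensteinDVRSetting κ hm S hpS hbad L hL hLS jbar cd D fs).T.ρ k).toLocal (Sum.inr v)) ((W.eisensteinDVRSetting κ hm S hpS hbad L hL hLS jbar cd D fs).T.red k).toAddMonoidHom continuous_of_discreteTopology
            (fun _ x ↦ (W.eisensteinDVRSetting κ hm S hpS hbad L hL hLS jbar cd D fs).T.red_equivariant k _ x) 1 = κ.eisensteinLocalReduce ρE tE hm (Sum.inr v) (k + 1) :=
          κ.cohomologyMap_toLocal_eq_eisensteinLocalReduce ρE tE hm htE (k + 1) (Sum.inr v)
        rw [e1, e2, e3]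
        exact h

end WeierstrassCurve

end
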